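import Literature.AlgebraicGeometry.HodgeTheory.VHSDataNilpotentOrbitFlatCharts
import Literature.AlgebraicGeometry.HodgeTheory.PolarizedLimitMixedHodgeStructureHodgeLocusNearPunctureRationalClass
import Literature.AlgebraicGeometry.Motives.TensorSpaceIntegralLattice
import Literature.AlgebraicGeometry.Motives.MumfordTateInvariantsScalarExtension
import Mathlib.Analysis.Complex.Convex
import HarnessLib

/-!
# A monodromy-stable full lattice for every limit mixed Hodge structure, and the UNCONDITIONAL model: the nilpotent orbit of
# every polarized limit mixed Hodge structure carries an integral structure making it a locally flat-charted `ℤ`-variation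

Topic `Literature/AlgebraicGeometry/HodgeTheory` (namespaces `Literature.AlgebraicGeometry.HodgeTheory.LimitMixedHodgeStructure` ∕
`….PolarizedLimitMixedHodgeStructure`), lane `lit-hodgefound` (seat `p08`, row g59-#6); the completion of `VHSDataNilpotentOrbitFlatCharts` (whose
charts assume a `T`-stable lattice `ι(M) ⊆ V`).  THEOREMS ONLY (no definition, no named fact, no instance — `preconnectedSpace_orbitBase` is a theorem used via `haveI`; D-0026 net debt `0`).

PRINTED SOURCES, VERBATIM.  E. Cattani, P. Deligne, A. Kaplan, *On the locus of Hodge classes*, J. AMS 8 (1995), (2.4) (p. 488): «on `ℋ^r`, the pullback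
of the local system `𝒱_ℤ` can be trivialized: `𝒱_ℤ = ℋ^r × V_ℤ` for `V_ℤ` a fixed lattice.  It is acted on by the monodromy»; E. Cattani et al. (eds.),
*Hodge Theory* (Math. Notes 49), §7.5 (7.5.2): «`γ_j = e^{N_j}` where `N_j` are nilpotent elements in `𝔤 ∩ 𝔤𝔩(V_ℚ)`»; C. Voisin, *Hodge Theory and Complex
Algebraic Geometry I*, §7.1.1 (integral structures: a lattice `V_ℤ` with `V_ℚ = V_ℤ ⊗ ℚ`).  That a unipotent RATIONAL automorphism `T` of a
finite-dimensional `ℚ`-space admits a `T`-STABLE full lattice (`Σ_j T^j Λ₀`, equivalently the `ℤ`-span of the `N^j b_i / j!`) is the standard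
remark behind «`V_ℤ` acted on by the monodromy» when one starts from `(V_ℚ, N)`.

CONTENT.
* §1 **`LimitMixedHodgeStructure.exists_fg_full_monodromy_mem`** — every limit mixed Hodge structure on a finite-dimensional `ℚ`-space has a
  finitely generated FULL subgroup `Λ ⊆ V` stable under the monodromy `T = e^N` (the sum over a `ℚ`-basis `(b_i)` of the tree's `T`-stable
  subgroups `ℤ⟨N^j b_i / j!⟩`, `exists_fg_monodromy_mem`); **`exists_isBaseChange_monodromy_mem`** — hence an INTEGRAL STRUCTURE
  `ι : ℤ^r → V` with `V = ℤ^r ⊗ ℚ` (Mathlib `IsBaseChange ℚ ι`) and `T(ι ℤ^r) ⊆ ι ℤ^r` (a `ℤ`-basis of `Λ` is a `ℚ`-basis of `V`, the tree's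
  `exists_basis_span_eq_of_lattice` and `isBaseChange_of_basis`).
* §2 **`exists_integralStructure_isLocallyFlatCharted_nilpotentOrbit`** — for EVERY polarized limit mixed Hodge structure `L` there is an integral
  structure `ι : ℤ^r → V` for which the nilpotent orbit variation `nilpotentOrbitVHSData L hι` over `{Im z > α}` is LOCALLY FLAT-CHARTED (global
  coordinate, end map): the chart interface of the tree's Cattani–Deligne–Kaplan theory is instantiated with no residual hypothesis beyond `L`.
* §3 over the (preconnected) half-plane, from the flat interior charts alone: for the orbit variation the set of Cor. 1.3 and the Hodge locus of
  norm `≤ K` are CLOSED and the whole half-plane or DISCRETE (`isClosed_determinationLocus_nilpotentOrbit_and_eq_univ_or`,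
  `isClosed_hodgeLocusOfNormLe_nilpotentOrbit_and_eq_univ_or`).

## References

* [CattaniDeligneKaplan1995] E. Cattani, P. Deligne, A. Kaplan, *On the locus of Hodge classes*, J. Amer. Math. Soc. 8 (1995), (2.4) (p. 488), Cor. 1.3 (p. 484).
* [CattaniElZeinGriffithsLe2014] E. Cattani, F. El Zein, P. A. Griffiths, Lê D. T. (eds.), *Hodge Theory*, Math. Notes 49 (2014), §7.5 (7.5.2) and Example 7.5.2 (p. 302).
* [VoisinHodgeI2002] C. Voisin, *Hodge Theory and Complex Algebraic Geometry I*, CUP (2002), §7.1.1.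
* [Schmid1973] W. Schmid, *Variation of Hodge structure: the singularities of the period mapping*, Invent. Math. 22 (1973), §2, (4.9)–(4.12).
* [FritzscheGrauert2002] K. Fritzsche, H. Grauert, *From Holomorphic Functions to Complex Manifolds*, GTM 213 (2002), Ch. I §8.
-/

noncomputable section

open scoped TensorProduct
open _root_.Topology _root_.Filter Set

universe u

namespace Literature.AlgebraicGeometry

open Module
open Motives Motives.MixedHodgeStructure Motives.HodgeStructure

namespace HodgeTheory

/-! ## §1 A monodromy-stable full lattice and integral structure -/

namespace LimitMixedHodgeStructure

variable {V : Type u} [AddCommGroup V] [Module ℚ V] [FiniteDimensional ℚ V] {k : ℤ} (L : LimitMixedHodgeStructure V k)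

/-- **A `T`-STABLE FULL LATTICE**: every limit mixed Hodge structure on a finite-dimensional `ℚ`-space `V` admits a finitely generated subgroup
`Λ ⊆ V`, stable under the monodromy `T = e^N`, in which every vector of `V` has a nonzero integral multiple (the sum over a `ℚ`-basis of the
`T`-stable subgroups spanned by the `N^j b / j!`). [cite: CattaniDeligneKaplan1995, (2.4) (p. 488)] [cite: CattaniElZeinGriffithsLe2014, §7.5 (7.5.2)] -/
theorem exists_fg_full_monodromy_mem :
    ∃ Λ : Submodule ℤ V, Λ.FG ∧ (∀ v ∈ Λ, L.monodromy v ∈ Λ) ∧ ∀ v : V, ∃ N : ℤ, N ≠ 0 ∧ N • v ∈ Λ := by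
  classical
  set b := Module.finBasis ℚ V
  choose Λ hfg hT hmem using fun i => L.exists_fg_monodromy_mem (b i)
  refine ⟨⨆ i, Λ i, Submodule.fg_iSup Λ hfg, fun v hv => ?_, fun v => ?_⟩
  · induction hv using Submodule.iSup_induction' with
    | mem i x hx => exact Submodule.mem_iSup_of_mem i (hT i x hx)
    | zero => rw [map_zero]; exact Submodule.zero_mem _
    | add x y _ _ hx hy => rw [map_add]; exact Submodule.add_mem _ hx hy
  · obtain ⟨N, hN, hNv⟩ := Motives.exists_nsmul_mem_span_of_basis b v
    refine ⟨N, by exact_mod_cast hN.ne', ?_⟩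
    have hle : Submodule.span ℤ (Set.range b) ≤ ⨆ i, Λ i := by
      rw [Submodule.span_le]
      rintro _ ⟨i, rfl⟩
      exact Submodule.mem_iSup_of_mem i (hmem i)
    exact hle hNv

/-- **AN INTEGRAL STRUCTURE STABLE UNDER THE MONODROMY**: for every limit mixed Hodge structure on `V` there are `r` and a `ℤ`-linear `ι : ℤ^r → V`
exhibiting `V = ℤ^r ⊗ ℚ` (`IsBaseChange ℚ ι`: a `ℤ`-basis of a `T`-stable full lattice is a `ℚ`-basis of `V`) with `T(ι ℤ^r) ⊆ ι ℤ^r` — «`V_ℤ` a fixed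
lattice … acted on by the monodromy». [cite: CattaniDeligneKaplan1995, (2.4) (p. 488)] [cite: VoisinHodgeI2002, §7.1.1] -/
theorem exists_isBaseChange_monodromy_mem :
    ∃ (r : ℕ) (ι : (Fin r → ℤ) →ₗ[ℤ] V), IsBaseChange ℚ ι ∧ ∀ u ∈ LinearMap.range ι, L.monodromy u ∈ LinearMap.range ι := by
  classical
  obtain ⟨Λ, hfg, hT, hfull⟩ := L.exists_fg_full_monodromy_mem
  obtain ⟨r, e, he⟩ := Motives.exists_basis_span_eq_of_lattice Λ hfg hfull
  refine ⟨r, Fintype.linearCombination ℤ (fun i => e i), ?_, ?_⟩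
  · refine Motives.isBaseChange_of_basis _ (Pi.basisFun ℤ (Fin r)) e fun i => ?_
    rw [Pi.basisFun_apply, Fintype.linearCombination_apply_single, one_smul]
  · intro u hu
    rw [Fintype.range_linearCombination] at hu ⊢
    have heq : Submodule.span ℤ (Set.range fun i => e i) = Λ := he
    rw [heq] at hu ⊢
    exact hT u hu

end LimitMixedHodgeStructure

/-! ## §2 The unconditional model: an integral structure for which the nilpotent orbit variation is locally flat-charted -/

namespace PolarizedLimitMixedHodgeStructure

variable {V : Type} [AddCommGroup V] [Module ℚ V] [FiniteDimensional ℚ V] {k : ℤ} (L : PolarizedLimitMixedHodgeStructure V k)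

/-- **FOR EVERY POLARIZED LIMIT MIXED HODGE STRUCTURE `L`, ITS NILPOTENT ORBIT IS A LOCALLY FLAT-CHARTED POLARIZED `ℤ`-VARIATION**: there is an
integral structure `ι : ℤ^r → V` (`V = ℤ^r ⊗ ℚ`, `ι(ℤ^r)` stable under `T = e^N`) such that the orbit variation `z ↦ (exp(zN_ℂ)·F, Q)` over
`{Im z > α}` on the trivial local systems `ℤ^r`, `V` is locally flat-charted for the global coordinate and the end map — the model case of the whole
Cattani–Deligne–Kaplan chart theory of the tree, with no residual hypothesis. [cite: CattaniDeligneKaplan1995, (2.4) (p. 488), 2.7 (p. 489), §1 (pp. 483–484)]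
[cite: CattaniElZeinGriffithsLe2014, §7.5 Example 7.5.2] [cite: Schmid1973, §2, (4.9)–(4.12)] -/
theorem exists_integralStructure_isLocallyFlatCharted_nilpotentOrbit :
    ∃ (r : ℕ) (ι : (Fin r → ℤ) →ₗ[ℤ] V) (hι : IsBaseChange ℚ ι),
      (L.nilpotentOrbitVHSData hι).IsLocallyFlatCharted (fun _ : Unit => L.orbitCoord) (fun _ : Unit => L.orbitEnd) := by
  obtain ⟨r, ι, hι, hT⟩ := L.toLimitMixedHodgeStructure.exists_isBaseChange_monodromy_mem
  exact ⟨r, ι, hι, L.isLocallyFlatCharted_nilpotentOrbitVHSData hι hT⟩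

/-- **… together with the flat puncture chart and a flat interior chart around every point** (the two chart structures of the tree inhabited by
the orbit). [cite: CattaniDeligneKaplan1995, (2.4) (p. 488), 2.7 (p. 489)] [cite: CattaniElZeinGriffithsLe2014, §7.5 Example 7.5.2] -/
theorem exists_integralStructure_punctureChart_interiorChart_nilpotentOrbit :
    ∃ (r : ℕ) (ι : (Fin r → ℤ) →ₗ[ℤ] V) (hι : IsBaseChange ℚ ι),
      (∃ C : (L.nilpotentOrbitVHSData hι).PunctureChart L.orbitEnd L, C.IsFlat) ∧
        ∀ x : L.orbitBase, ∃ r' > 0, Metric.ball (L.orbitCoord x) r' ⊆ L.orbitCoord.target ∧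
          ∃ C : (L.nilpotentOrbitVHSData hι).InteriorChart (Topology.restrBall L.orbitCoord x r') (L.nilpotentOrbitPolarization x.1 x.2), C.IsFlat := by
  obtain ⟨r, ι, hι, hT⟩ := L.toLimitMixedHodgeStructure.exists_isBaseChange_monodromy_mem
  exact ⟨r, ι, hι, ⟨L.nilpotentOrbitPunctureChart hι hT, L.isFlat_nilpotentOrbitPunctureChart hι hT⟩,
    fun x => L.exists_isFlat_interiorChart_nilpotentOrbit hι x⟩

/-! ## §3 Over the half-plane: the loci of the orbit variation are closed, and everything or discrete -/

/-- The half-plane `{Im z > α}` is preconnected (convex). [cite: CattaniElZeinGriffithsLe2014, §7.5 Example 7.5.2] -/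
theorem preconnectedSpace_orbitBase : PreconnectedSpace L.orbitBase :=
  Subtype.preconnectedSpace (convex_halfSpace_im_gt L.orbitThreshold).isPreconnected

/-- **For the nilpotent orbit variation (any `T`-stable integral structure), the set of `z` in the half-plane where SOME determination of an
integral `u₀` is of type `(p, p)` is CLOSED, and is the whole half-plane or DISCRETE** (every point has a punctured neighbourhood off it) — Cor. 1.3
for the model, from its flat interior charts alone. [cite: CattaniDeligneKaplan1995, Cor. 1.3 (p. 484)] [cite: CattaniElZeinGriffithsLe2014, §7.5 Example 7.5.2]
[cite: FritzscheGrauert2002, Ch. I §8 (after Prop. 8.1, n = 1)] -/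
theorem isClosed_determinationLocus_nilpotentOrbit_and_eq_univ_or {M : Type} [AddCommGroup M] [Module.Finite ℤ M] [Module.Free ℤ M]
    {ι : M →ₗ[ℤ] V} (hι : IsBaseChange ℚ ι) (hT : ∀ u ∈ LinearMap.range ι, L.monodromy u ∈ LinearMap.range ι) {p : ℤ} (hpk : p + p = k)
    {s₀ : L.orbitBase} (u₀ : (L.nilpotentOrbitVHSData hι).VZ.fiber s₀) :
    IsClosed {t : L.orbitBase | ∃ γ : Path.Homotopic.Quotient s₀ t,
        (L.nilpotentOrbitVHSData hι).IsHodgeAt t p ((L.nilpotentOrbitVHSData hι).VZ.transport γ u₀)} ∧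
      ({t : L.orbitBase | ∃ γ : Path.Homotopic.Quotient s₀ t,
          (L.nilpotentOrbitVHSData hι).IsHodgeAt t p ((L.nilpotentOrbitVHSData hι).VZ.transport γ u₀)} = univ ∨
        ∀ x : L.orbitBase, ∀ᶠ y in 𝓝[≠] x, y ∉ {t : L.orbitBase | ∃ γ : Path.Homotopic.Quotient s₀ t,
          (L.nilpotentOrbitVHSData hι).IsHodgeAt t p ((L.nilpotentOrbitVHSData hι).VZ.transport γ u₀)}) := by
  haveI := L.preconnectedSpace_orbitBase
  exact (L.isLocallyFlatCharted_nilpotentOrbitVHSData hι hT).isClosed_determinationLocus_and_eq_univ_or_forall_eventually_not_mem hpk u₀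
    fun x => ⟨(), by rw [orbitCoord_source]; exact mem_univ x⟩

/-- **… and the Hodge locus of norm `≤ K` of the orbit variation is closed, and the whole half-plane or discrete** (Thm. 1.1 for the model, interior
charts alone). [cite: CattaniDeligneKaplan1995, §1 (p. 484), Thm. 1.1] [cite: CattaniElZeinGriffithsLe2014, §7.5 Example 7.5.2] -/
theorem isClosed_hodgeLocusOfNormLe_nilpotentOrbit_and_eq_univ_or {M : Type} [AddCommGroup M] [Module.Finite ℤ M] [Module.Free ℤ M]
    {ι : M →ₗ[ℤ] V} (hι : IsBaseChange ℚ ι) (hT : ∀ u ∈ LinearMap.range ι, L.monodromy u ∈ LinearMap.range ι) {p : ℤ} (hpk : p + p = k) (K : ℤ) :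
    IsClosed ((L.nilpotentOrbitVHSData hι).hodgeLocusOfNormLe p K) ∧
      ((L.nilpotentOrbitVHSData hι).hodgeLocusOfNormLe p K = univ ∨
        ∀ x : L.orbitBase, ∀ᶠ y in 𝓝[≠] x, y ∉ (L.nilpotentOrbitVHSData hι).hodgeLocusOfNormLe p K) := by
  haveI := L.preconnectedSpace_orbitBase
  exact (L.isLocallyFlatCharted_nilpotentOrbitVHSData hι hT).isLocallyCharted.isClosed_hodgeLocusOfNormLe_and_eq_univ_or_forall_eventually_not_mem
    hpk K fun x => ⟨(), by rw [orbitCoord_source]; exact mem_univ x⟩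

end PolarizedLimitMixedHodgeStructure

end HodgeTheory

end Literature.AlgebraicGeometry

end
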